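import Literature.NumberTheory.GaloisRepresentations.DiscreteCochainsLongExact
import HarnessLib

/-!
# T-42-mult in the kernel, XXXVI: a generic `H²` tool (a composite that is a scalar acts as that scalar
# on `H²`)

Cell `bsd-2adic` (run/shared/lean/pub/bsd-2adic/), seat `bsd-2adic-t42`, GEN 17. HONEST FRAMING: research
route; THEOREMS ONLY (no `def`, no named fact, no instance); nothing booked; nothing re-keyed (RC-169); BSD is
not proved by any of this. PARTITION: X5@2 multiplicative GV-transport rows (K4ᵐ O1 `MultCongruenceTransportAtTwo`,
the residual `T2` of `hF3b_of_prop49_T2`, file XXX) × p = 2 — generic-tool-for; bears_on K4 items 19922 / 19923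
(`--supports stmt-BirchSwinnertonDyer-19923`). Brick (e) of HOME/t42/DESIGN-T42-ADDENDUM-18.md §A18.3 (the
level-raising step killing the obstruction `δ₁[ξ] ∈ H²(Γ_{ℚ_v}, C_J(χ_u))` by passing from `C_J` to `C_{J+m}`).

## What (generic, any compact / locally compact group, Mathlib's `continuousCohomology`)

* `cohomologyMap_two_comp_eq_smul` — if `b ∘ a = r •` on a topological module `X` (`a : X ⟶ Y`,
  `b : Y ⟶ X` morphisms of `TopRep`s) then `H²(b) ∘ H²(a) = r •` on `H²(Γ, X)` (inhomogeneous `2`-cocycles: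
  `H²(f)[c] = [f ∘ c]`, `[r c] = r [c]`). Used with `a = ·2^m : C_{J+m} ↠ C_J`, `b = incl : C_J ↪ C_{J+m}`.
* (the companion fact "`H²(g)` is onto when `H³(Γ, M₁) = 0`" is the tree's
  `IsSES.exists_map_two_eq_of_subsingleton_three`, file `ContinuousCohomologyNineTerm`; used with
  `0 → C_m → C_{J+m} →(·2^m) C_J → 0` over `Γ_{ℚ_v}`, `cd_2 Γ_{ℚ_v} ≤ 2`).

References: [SerreGaloisCohomology1997] I §2.2–2.3; [NeukirchSchmidtWingberg2008] (1.3.2); [Shatz1972] II §1 Prop. 3.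
-/

set_option autoImplicit false
set_option linter.dupNamespace false

noncomputable section

universe u

namespace Summit.BirchSwinnertonDyer.BirchSwinnertonDyer.Theorems.MultTransportTwistedDescent

open CategoryTheory Function Literature.NumberTheory.GaloisRepresentations ContinuousCohomology TopRep
  ContRepresentation

section Scalar

variable {k : Type u} [CommRing k] [TopologicalSpace k]
  {G : Type u} [Group G] [TopologicalSpace G] [IsTopologicalGroup G] [LocallyCompactSpace G]

/-- **A composite that is multiplication by `r` acts as `r` on `H²`.** If `b (a x) = r • x` for all `x`
(`a : X ⟶ Y`, `b : Y ⟶ X`), then `H²(b) (H²(a) y) = r • y` (`H²(f)[c] = [f ∘ c]` on inhomogeneous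
`2`-cocycles). [cite: SerreGaloisCohomology1997, I §2.2] [cite: NeukirchSchmidtWingberg2008, (1.3.2)] -/
theorem cohomologyMap_two_comp_eq_smul {X Y : TopRep.{u} k G} (a : X ⟶ Y) (b : Y ⟶ X) (r : k)
    (hab : ∀ x : X, b.hom (a.hom x) = r • x) (y : continuousCohomology 2 X) :
    cohomologyMap b 2 (cohomologyMap a 2 y) = r • y := by
  obtain ⟨c, rfl⟩ := twoCocycleClass_surjective X y
  rw [cohomologyMap_twoCocycleClass, cohomologyMap_twoCocycleClass, ← twoCocycleClass_smul]
  refine congrArg _ (Subtype.ext (ContinuousMap.ext fun p ↦ ?_))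
  obtain ⟨σ, τ⟩ := p
  rw [pullback₂_id_resIdHom_apply, pullback₂_id_resIdHom_apply, hab]
  rfl

end Scalar


end Summit.BirchSwinnertonDyer.BirchSwinnertonDyer.Theorems.MultTransportTwistedDescent

end
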